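import Summits.Ventures.DiscreteObjects.Hadamard.ReversalTurynType668
import Literature.Combinatorics.Designs.SixTurynType

/-!
# Hadamard 668 census — the 6-Turyn-type line `2m + n = 167`: the weight-one pair is never reversal-closed
# (`3 ≤ m ≤ 82`; kernel, parity of aperiodic autocorrelations at shift 2)

Framing: lottery ticket; floor = certified bounds/negative ranges.

Cell pub-namedobj (venture DiscreteObjects), target (H), hadamard gen 26.  6-Turyn-type sequences `(x; y; z; w)` of lengths
`m, m, m, n` (`N_x + N_y + 2N_z + 2N_w = 0`; SY 2020 Def. 5.3; `TT(m)` is the case `n = m - 1`) give `H(4(2m + n))`, so the whole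
line `2m + n = 167`, `1 ≤ m ≤ 83`, is a route to `H(668)` (`SixTurynTypeFamily668`).  On that line `n` is odd.  Extending
`ReversalTurynType668` (even `m`) to every `m`:
* `npaf_reflect_mod_four_odd` — for a reversal-symmetric/skew `±1` sequence `u` (`u' = εu`) of length `L` and a shift `s` with
  `L - s` ODD, `N_u(s) ≡ (L - s) - 1 + ε (mod 4)` (the middle product is `u_h u_{L-1-h} = ε`); `pmOn_skew_odd_false` — a `±1`
  sequence of odd length is never reversal-skew (middle entry);
* **`no_mutualReversePair_sixTurynType`** — `n ≥ 3` odd, `m ≥ 2`: no 6-Turyn-type `(x; y; z; w)` has `y = αx'` (`N_y = N_x` makes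
  `N_x(2) + N_z(2) + N_w(2) = 0`, of odd parity);
* **`no_symmetricSkewPair_sixTurynType_even`** / **`_odd`** / **`no_symmetricSkewPair_sixTurynType`** — `n ≥ 3` odd, `m ≥ 3`: no
  6-Turyn-type has `x' = αx` and `y' = βy` (even `m`: `N_x(2) + N_y(2) + 2N_z(2) ≡ 0`, `2N_w(2) ≡ 2 (mod 4)`; odd `m`: skew is
  impossible and for symmetric `x, y` every term is `≡ 2 (mod 4)`, total `≡ 2`);
* **`no_reversalClosedPair_sixTurynType`** — the signed-permutation form; **`no_reversalClosedPair_sixTurynType_167`** — on the line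
  `2m + n = 167`, for EVERY `3 ≤ m ≤ 82`, the weight-one pair `{±x, ±y}` of a 6-Turyn-type quadruple is never closed under reversal
  (`m = 83`, `n = 1` is untouched: there `N_w(2) = 0`; `m ≤ 2` is degenerate).  Nothing is assumed about `z, w`.
Brute force outside the kernel (all 6-Turyn-type quadruples for `(m, n) ∈ {(4,3),(4,5),(6,3),(3,3),(5,3),(3,5)}`: no structured pair;
`(4,1)`: 128 of 256 have `y = ±x'`, so `n ≥ 3` is needed).  NEGATIVE lines about hypothetical objects (structured sub-families of an
open family); no Hadamard order excluded; H(668) untouched; HITS 0/4.  Ours, elementary; no `sorry`; `decide` only on `Equiv.Perm (Fin 2)`.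
-/

open Finset BigOperators

namespace Summit.Ventures.DiscreteObjects.Hadamard

open Literature.Combinatorics.Designs.TSequences
open Literature.Combinatorics.Designs.TurynTypeSymmetries
open Literature.Combinatorics.Designs.SixTurynType

/-! ## Two more parity tools -/

/-- **`N_u(s) ≡ (L - s) - 1 + ε (mod 4)`** for a `±1` sequence with `u(L-1-i) = ε u(i)` when `L - s` is ODD: the products
`u_i u_{i+s}` pair off under `i ↦ L - s - 1 - i` except the middle one, which equals `ε`. -/
theorem npaf_reflect_mod_four_odd {L s : ℕ} {u : ℕ → ℤ} (hu : PMOn L u) {ε : ℤ} (hε : ε = 1 ∨ ε = -1)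
    (hrev : ∀ i, i < L → u (L - 1 - i) = ε * u i) (hs : s ≤ L) (hodd : Odd (L - s)) :
    ∃ k : ℤ, NPAF L u s = ((L - s : ℕ) : ℤ) - 1 + ε - 4 * k := by
  obtain ⟨h, hh⟩ := hodd
  set f : ℕ → ℤ := fun i => u i * u (i + s) with hf
  have hε2 : ε * ε = 1 := by rcases hε with e | e <;> simp [e]
  have hsym : ∀ i, i < h → f (h + 1 + (h - 1 - i)) = f i := fun i hi => by
    simp only [hf]
    have e1 : h + 1 + (h - 1 - i) = L - 1 - (i + s) := by omega
    have e2 : L - 1 - (i + s) + s = L - 1 - i := by omega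
    rw [e1, e2, hrev (i + s) (by omega), hrev i (by omega)]
    calc ε * u (i + s) * (ε * u i) = (ε * ε) * (u i * u (i + s)) := by ring
      _ = u i * u (i + s) := by rw [hε2, one_mul]
  have hmid : f h = ε := by
    simp only [hf]
    rw [show h + s = L - 1 - h by omega, hrev h (by omega)]
    rcases hu h (by omega) with e | e <;> rw [e] <;> ring
  have hsplit : NPAF L u s = 2 * ∑ i ∈ range h, f i + ε := by
    unfold NPAF
    rw [show L - s = (h + 1) + h by omega, Finset.sum_range_add, Finset.sum_range_succ, two_mul, ← hmid]
    have e3 : ∑ i ∈ range h, f (h + 1 + i) = ∑ i ∈ range h, f i := by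
      rw [← Finset.sum_range_reflect (fun i => f (h + 1 + i)) h]
      exact Finset.sum_congr rfl fun i hi => hsym i (mem_range.mp hi)
    rw [e3]
    ring
  have hprod : PMOn h f := fun i hi => by
    simp only [hf]
    rcases hu i (by omega) with e | e <;> rcases hu (i + s) (by omega) with e' | e' <;> simp [e, e']
  obtain ⟨k, hk⟩ := sum_pm_parity hprod
  refine ⟨k, ?_⟩
  rw [hsplit, hk, show ((L - s : ℕ) : ℤ) = (h : ℤ) + h + 1 by rw [hh]; push_cast; ring]
  ring

/-- a `±1` sequence of ODD length is never reversal-skew (its middle entry would vanish). -/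
theorem pmOn_skew_odd_false {L : ℕ} {u : ℕ → ℤ} (hu : PMOn L u) (hodd : Odd L)
    (hrev : ∀ i, i < L → u (L - 1 - i) = -1 * u i) : False := by
  obtain ⟨h, hh⟩ := hodd
  have e := hrev h (by omega)
  rw [show L - 1 - h = h by omega] at e
  rcases hu h (by omega) with f | f <;> rw [f] at e <;> norm_num at e

section General

variable {m n : ℕ} {x y z w : ℕ → ℤ}

/-- **no 6-Turyn-type `(m; n)`, `n ≥ 3` odd, `m ≥ 2`, with `y = αx'`.** -/
theorem no_mutualReversePair_sixTurynType (hn : Odd n) (h3 : 3 ≤ n) (hm : 2 ≤ m) (h : IsSixTurynType m n x y z w)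
    {α : ℤ} (hα : α = 1 ∨ α = -1) (hy : ∀ i, i < m → y i = α * x (m - 1 - i)) : False := by
  obtain ⟨hxp, -, hzp, hwp, -⟩ := id h
  have h2 := h.npaf (s := 2) (by norm_num)
  have hNy : NPAF m y 2 = NPAF m x 2 := by
    rcases hα with rfl | rfl
    · rw [npaf_congr (u := rev m x) (fun i hi => by rw [hy i hi, one_mul]; rfl), npaf_rev]
    · rw [npaf_congr (u := neg (rev m x)) (fun i hi => by rw [hy i hi]; simp [neg, rev]), npaf_neg', npaf_rev]
  obtain ⟨kx, hkx⟩ := npaf_pm_parity hxp hm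
  obtain ⟨kz, hkz⟩ := npaf_pm_parity hzp hm
  obtain ⟨kw, hkw⟩ := npaf_pm_parity hwp (show 2 ≤ n by omega)
  rw [hNy, hkx, hkz, hkw] at h2
  obtain ⟨t, ht⟩ := hn
  have e1 : ((n - 2 : ℕ) : ℤ) = 2 * t - 1 := by omega
  rw [e1] at h2
  omega

/-- **no 6-Turyn-type `(m; n)`, `n ≥ 3` odd, `m ≥ 4` even, with `x' = αx` and `y' = βy`** (shift 2, mod 4). -/
theorem no_symmetricSkewPair_sixTurynType_even (hn : Odd n) (h3 : 3 ≤ n) (hme : Even m) (hm : 4 ≤ m)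
    (h : IsSixTurynType m n x y z w) {α β : ℤ} (hα : α = 1 ∨ α = -1) (hβ : β = 1 ∨ β = -1)
    (hx : ∀ i, i < m → x (m - 1 - i) = α * x i) (hy : ∀ i, i < m → y (m - 1 - i) = β * y i) : False := by
  obtain ⟨hxp, hyp, hzp, hwp, -⟩ := id h
  have h2 := h.npaf (s := 2) (by norm_num)
  have hev : Even (m - 2) := by
    obtain ⟨t, ht⟩ := hme
    exact ⟨t - 1, by omega⟩
  obtain ⟨kx, hkx⟩ := npaf_reflect_mod_four hxp hα hx (by omega) hev
  obtain ⟨ky, hky⟩ := npaf_reflect_mod_four hyp hβ hy (by omega) hev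
  obtain ⟨kz, hkz⟩ := npaf_pm_parity hzp (show 2 ≤ m by omega)
  obtain ⟨kw, hkw⟩ := npaf_pm_parity hwp (show 2 ≤ n by omega)
  rw [hkx, hky, hkz, hkw] at h2
  obtain ⟨t, ht⟩ := hn
  obtain ⟨u, hu⟩ := hme
  have e1 : ((n - 2 : ℕ) : ℤ) = 2 * t - 1 := by omega
  have e2 : ((m - 2 : ℕ) : ℤ) = 2 * u - 2 := by omega
  rw [e1, e2] at h2
  omega

/-- **no 6-Turyn-type `(m; n)`, `n ≥ 3` odd, `m ≥ 3` odd, with `x' = αx` and `y' = βy`**: skew is impossible at odd length, and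
for symmetric `x, y` every term of `N_x(2) + N_y(2) + 2N_z(2) + 2N_w(2)` is `≡ 2 (mod 4)` up to the factor structure: total `≡ 2`. -/
theorem no_symmetricSkewPair_sixTurynType_odd (hn : Odd n) (h3 : 3 ≤ n) (hmo : Odd m) (hm : 3 ≤ m)
    (h : IsSixTurynType m n x y z w) {α β : ℤ} (hα : α = 1 ∨ α = -1) (hβ : β = 1 ∨ β = -1)
    (hx : ∀ i, i < m → x (m - 1 - i) = α * x i) (hy : ∀ i, i < m → y (m - 1 - i) = β * y i) : False := by
  obtain ⟨hxp, hyp, hzp, hwp, -⟩ := id h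
  -- skew components are impossible at odd length
  rcases hα with rfl | rfl
  swap
  · exact pmOn_skew_odd_false hxp hmo hx
  rcases hβ with rfl | rfl
  swap
  · exact pmOn_skew_odd_false hyp hmo hy
  have h2 := h.npaf (s := 2) (by norm_num)
  have hod : Odd (m - 2) := by
    obtain ⟨t, ht⟩ := hmo
    exact ⟨t - 1, by omega⟩
  obtain ⟨kx, hkx⟩ := npaf_reflect_mod_four_odd hxp (Or.inl rfl) hx (by omega) hod
  obtain ⟨ky, hky⟩ := npaf_reflect_mod_four_odd hyp (Or.inl rfl) hy (by omega) hod
  obtain ⟨kz, hkz⟩ := npaf_pm_parity hzp (show 2 ≤ m by omega)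
  obtain ⟨kw, hkw⟩ := npaf_pm_parity hwp (show 2 ≤ n by omega)
  rw [hkx, hky, hkz, hkw] at h2
  obtain ⟨t, ht⟩ := hn
  obtain ⟨u, hu⟩ := hmo
  have e1 : ((n - 2 : ℕ) : ℤ) = 2 * t - 1 := by omega
  have e2 : ((m - 2 : ℕ) : ℤ) = 2 * u - 1 := by omega
  rw [e1, e2] at h2
  omega

/-- **no 6-Turyn-type `(m; n)`, `n ≥ 3` odd, `m ≥ 3`, with a reversal-symmetric/skew weight-one pair** (`x' = αx`, `y' = βy`). -/
theorem no_symmetricSkewPair_sixTurynType (hn : Odd n) (h3 : 3 ≤ n) (hm : 3 ≤ m) (h : IsSixTurynType m n x y z w)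
    {α β : ℤ} (hα : α = 1 ∨ α = -1) (hβ : β = 1 ∨ β = -1) (hx : ∀ i, i < m → x (m - 1 - i) = α * x i)
    (hy : ∀ i, i < m → y (m - 1 - i) = β * y i) : False := by
  rcases Nat.even_or_odd m with hme | hmo
  · have h4 : 4 ≤ m := by
      obtain ⟨t, ht⟩ := hme
      omega
    exact no_symmetricSkewPair_sixTurynType_even hn h3 hme h4 h hα hβ hx hy
  · exact no_symmetricSkewPair_sixTurynType_odd hn h3 hmo hm h hα hβ hx hy

/-- **signed-permutation form: for `n ≥ 3` odd and `m ≥ 3` the weight-one pair `{±x, ±y}` of a 6-Turyn-type `(m; n)` quadruple is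
never closed under reversal** (`(x,y)_{σ j}(m-1-i) = e_j (x,y)_j(i)`). -/
theorem no_reversalClosedPair_sixTurynType (hn : Odd n) (h3 : 3 ≤ n) (hm : 3 ≤ m) (h : IsSixTurynType m n x y z w)
    {σ : Equiv.Perm (Fin 2)} {e : Fin 2 → ℤ} (he : ∀ j, e j = 1 ∨ e j = -1)
    (hxy : ∀ j, ∀ i, i < m → (![x, y] (σ j)) (m - 1 - i) = e j * (![x, y] j) i) : False := by
  have hσ2 : ∀ τ : Equiv.Perm (Fin 2), τ = 1 ∨ τ = Equiv.swap 0 1 := by decide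
  rcases hσ2 σ with rfl | rfl
  · exact no_symmetricSkewPair_sixTurynType hn h3 hm h (he 0) (he 1)
      (fun i hi => by simpa using hxy 0 i hi) (fun i hi => by simpa using hxy 1 i hi)
  · have hy' : ∀ i, i < m → y (m - 1 - i) = e 0 * x i := fun i hi => by simpa using hxy 0 i hi
    refine no_mutualReversePair_sixTurynType hn h3 (by omega) h (he 0) fun i hi => ?_
    have := hy' (m - 1 - i) (by omega)
    rwa [show m - 1 - (m - 1 - i) = i by omega] at this

end General

/-! ## The line `2m + n = 167` -/

section L167

variable {m n : ℕ} {x y z w : ℕ → ℤ}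

/-- **on the 6-Turyn-type line to `H(668)` (`2m + n = 167`, `2 ≤ m ≤ 82`) the weight-one pair is never a pair of mutual
reverses** (`y = αx'`). -/
theorem no_mutualReversePair_sixTurynType_167 (hmn : 2 * m + n = 167) (hm : 2 ≤ m) (hm' : m ≤ 82)
    (h : IsSixTurynType m n x y z w) {α : ℤ} (hα : α = 1 ∨ α = -1) (hy : ∀ i, i < m → y i = α * x (m - 1 - i)) :
    False :=
  no_mutualReversePair_sixTurynType ⟨83 - m, by omega⟩ (by omega) hm h hα hy

/-- **on the 6-Turyn-type line to `H(668)` (`2m + n = 167`, `3 ≤ m ≤ 82`) the weight-one pair is never reversal-symmetric/skew**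
(`x' = αx`, `y' = βy`, any signs). -/
theorem no_symmetricSkewPair_sixTurynType_167 (hmn : 2 * m + n = 167) (hm : 3 ≤ m) (hm' : m ≤ 82)
    (h : IsSixTurynType m n x y z w) {α β : ℤ} (hα : α = 1 ∨ α = -1) (hβ : β = 1 ∨ β = -1)
    (hx : ∀ i, i < m → x (m - 1 - i) = α * x i) (hy : ∀ i, i < m → y (m - 1 - i) = β * y i) : False :=
  no_symmetricSkewPair_sixTurynType ⟨83 - m, by omega⟩ (by omega) hm h hα hβ hx hy

/-- **the 6-Turyn-type line to `H(668)`: for EVERY `3 ≤ m ≤ 82` the weight-one pair `{±x, ±y}` is never closed under reversal**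
(signed-permutation form; `m = 83`, `n = 1` untouched).  The structured sub-family of the whole line is EMPTY; unstructured
6-Turyn-type quadruples remain OPEN (in print only the points `n = m - 1 = TT(m)`, `m ≤ 40` or so, were searched).
lottery ticket; floor = certified bounds/negative ranges. -/
theorem no_reversalClosedPair_sixTurynType_167 (hmn : 2 * m + n = 167) (hm : 3 ≤ m) (hm' : m ≤ 82)
    (h : IsSixTurynType m n x y z w) {σ : Equiv.Perm (Fin 2)} {e : Fin 2 → ℤ} (he : ∀ j, e j = 1 ∨ e j = -1)
    (hxy : ∀ j, ∀ i, i < m → (![x, y] (σ j)) (m - 1 - i) = e j * (![x, y] j) i) : False :=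
  no_reversalClosedPair_sixTurynType ⟨83 - m, by omega⟩ (by omega) hm h he hxy

end L167

end Summit.Ventures.DiscreteObjects.Hadamard
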